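import Literature.MathematicalPhysics.QuantumLattice.HubbardTTPrimePhaseCoexistenceExclusion
import Literature.MathematicalPhysics.QuantumLattice.SuperlatticeCellFillingConvexity
import Literature.MathematicalPhysics.QuantumLattice.PeriodicPressureSuperlatticeIndependence
import HarnessLib

/-!
# Phase-coexistence exclusion for SUPERLATTICE-PERIODIC phases (stripes, antiferromagnets, charge / spin density waves):
# a certified strict-convexity defect of `n ↦ e(t,t',U,n)` excludes macroscopic separation into ANY two periodic phases

Topic `Literature/MathematicalPhysics/QuantumLattice` (family `hubbard`). Sequel of `HubbardTTPrimePhaseCoexistenceExclusion`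
(the TRANSLATION-INVARIANT statement: a certified cap/floors defect `c < a f₁ + b f₂` of the ground-state energy density
`e(n) = energyDensityTT' t t' U n` across `[n₁, n₂]` implies that no mixture `λω₁ + (1−λ)ω₂` of translation-invariant states of
densities `ρ(ω₁) ≤ n₁`, `n₂ ≤ ρ(ω₂)` is a ground state — Israel's super-segment form of strict convexity) and of
`PeriodicStatesCellAverage` / `SuperlatticeCellEnergyFamilies` / `SuperlatticeCellFillingConvexity` (superlattice-periodic states
`ω.IsPeriodic q`, their CELL FILLING `ω.cellFilling q = |C|⁻¹ Σ_{n∈C} ρ(ω ∘ τ_{pos n})` and CELL ENERGY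
`ω.cellEnergy (fun _ => Φ) R = |C|⁻¹ Σ_{n∈C} e_Φ(ω ∘ τ_{pos n})` — the filling and the energy PER SITE of a stripe / Néel /
density-wave state — both AFFINE under mixing, and the cell average `ω.cellAverage q`, a translation-invariant state carrying exactly
these two numbers).

THE POINT. The competing orders of record near `(U, n) = (8, 7/8)` — the Néel antiferromagnet at half filling (period 2), stripes
(period 4–8), charge / spin density waves — are NOT translation invariant as states; the phase-separation sentences of the
certified-solver programme (`Observables/PhaseSeparationExclusion*`, hubbard-box-p1 / -p3, hubbard-downfold-unc-2) are worded for
translation-invariant components and say so («WHAT THIS IS NOT: a statement about stripes or finite-period states»). This file removes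
the restriction once, at the level of infinite-volume states: the cell averages `ω̄ᵢ = ωᵢ.cellAverage q` of two `q`-periodic phases are
translation invariant with densities `ρ̄ᵢ = ωᵢ.cellFilling q` and mean energies `Ēᵢ = ωᵢ.cellEnergy q`, and the macroscopic mixture
`λω₁ + (1−λ)ω₂` has cell filling `λρ̄₁ + (1−λ)ρ̄₂` and cell energy `λĒ₁ + (1−λ)Ē₂` (`cellFilling_mix`, `cellEnergy_mix`) — the SAME two
numbers as the translation-invariant mixture `λω̄₁ + (1−λ)ω̄₂` (§1). Hence every translation-invariant exclusion theorem transfers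
verbatim (§2 the generic transfer, §3 the certified cap/floors, strict-defect and energy-gap forms): **if `c < a f₁ + b f₂` is certified
across `[n₁, n₂]`, then for every pair of superlattice-periodic states (any common period lattice) with cell fillings `ρ̄(ω₁) ≤ n₁`,
`n₂ ≤ ρ̄(ω₂)` and every `0 < λ < 1`, the phase-separated state `λω₁ + (1−λ)ω₂` has energy per site STRICTLY ABOVE `e` at its own
filling** — a translation-invariant state of the same filling (its own cell average already competes in that class) does strictly
better, so it is not a ground state. Two phases with different period lattices `q₁`, `q₂` are both periodic under any common
coarsening (`IsPeriodic.of_dvd`; `Q_i + 1 = (q₁_i + 1)(q₂_i + 1)` always works, §4).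

HONEST SCOPE: statements about infinite-volume states and two-component convex decompositions; `cellEnergy` / `cellFilling` are the
cell-averaged energy density / filling of `PeriodicStatesCellAverage` §3 (their identification with `lim ω(H_Λ)/|Λ|` for periodic `ω` is
the periodic twin of Bratteli–Robinson II Prop. 6.2.4 and is not restated); aperiodic (quasi-crystalline, glassy) components are not
covered; nothing here is a certificate or a number. Everything is PROVED; no definition, no named fact, no `sorry`.

## Mathlib / tree search

REUSED: `IsTranslationInvariant.energyDensityTT'_lt_meanEnergy_mix_of_cap_lt_floors_of_le`, `…_of_strict_at_of_le`,
`IsTranslationInvariant.convexComb_floors_le_meanEnergy_mix`, `…energyDensityTT'_add_margin_le_meanEnergy_mix`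
(`HubbardTTPrimePhaseCoexistenceExclusion`); `InfVolFermionState.IsPeriodic`, `IsPeriodic.isTranslationInvariant_cellAverage`,
`cellAverage` (`PeriodicStatesCellAverage`); `cellFilling`, `cellEnergy`, `cellFilling_eq_density_cellAverage`, `cellEnergy_const`
(`SuperlatticeCellEnergyFamilies`); `IsPeriodic.mix`, `cellFilling_mix`, `cellEnergy_mix` (`SuperlatticeCellFillingConvexity`);
`IsPeriodic.of_dvd` (`PeriodicPressureSuperlatticeIndependence`); `density_mix`, `meanEnergy_mix` (`InfVolFermionStateMixture` /
`InfVolFermionState`). `lean search 'IsPeriodic.*mix_of|cellEnergy_mix_eq|periodic.*coexist'` (QuantumLattice, 2026-08-28): nothing —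
`TIClassPhaseCoexistenceExclusion`'s header records the gap («periodic / finite-period states … are not excluded»).
presearch: «phase separation of periodic (stripe) phases ⇐ strict convexity of e(n)» → [corpus: israel2015-convexity-theory-lattice-gases
p. 18 (Thm. I.2.4, invariant states)] gives the translation-invariant statement only; galaxy «phase separation|Maxwell construction»: none.

## References

* R. B. Israel, *Convexity in the Theory of Lattice Gases* (1979), Thm. I.2.4 (strict convexity and coexistence). [cite: Israel1979, Thm. I.2.4]
* V. J. Emery, S. A. Kivelson, H. Q. Lin, Phys. Rev. Lett. 64 (1990) 475–478 (phase separation of holes in an antiferromagnet; Maxwell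
  construction on `e(n)`). [cite: EmeryKivelsonLin1990, pp. 475–476]
* O. Bratteli, D. W. Robinson, *OAQSM 1* (1987), §4.3.1 (averages over a group action; convexity of the state space). [cite: BratteliRobinsonI1987, §4.3.1]
* D. Ruelle, *Statistical Mechanics: Rigorous Results* (1969), §3.4 (convexity in the density). [cite: Ruelle1969, §3.4]
-/

noncomputable section

open scoped ComplexOrder BigOperators
open Finset

namespace Literature.MathematicalPhysics.QuantumLattice

open Matrix HubbardWave0 Literature.Probability.LatticeModels ThermodynamicLimit

namespace InfVolFermionState

variable {d : ℕ} {q : Fin d → ℕ}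

/-! ### §1 The two numbers of a mixture of periodic states are those of the mixture of their cell averages -/

/-- **Cell filling of a mixture = density of the mixture of the cell averages**:
`ρ̄(λω₁ + (1−λ)ω₂) = ρ(λω̄₁ + (1−λ)ω̄₂)` (`ω̄ᵢ = ωᵢ.cellAverage q`; both sides equal `λρ̄(ω₁) + (1−λ)ρ̄(ω₂)`, by
`cellFilling_mix`, `density_mix`, `cellFilling_eq_density_cellAverage`). Holds for all states. [cite: BratteliRobinsonI1987, §4.3.1] -/
theorem cellFilling_mix_eq_density_mix_cellAverage (t : ℝ) (ht₀ : 0 ≤ t) (ht₁ : t ≤ 1) (ω₁ ω₂ : InfVolFermionState d) :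
    (InfVolFermionState.mix t ht₀ ht₁ ω₁ ω₂).cellFilling q =
      (InfVolFermionState.mix t ht₀ ht₁ (ω₁.cellAverage q) (ω₂.cellAverage q)).density := by
  rw [cellFilling_mix, density_mix, ω₁.cellFilling_eq_density_cellAverage, ω₂.cellFilling_eq_density_cellAverage]

/-- **Cell energy of a mixture (translation-invariant model, constant views) = mean energy of the mixture of the cell averages**:
`Ē(λω₁ + (1−λ)ω₂) = e_Φ(λω̄₁ + (1−λ)ω̄₂)` (both sides equal `λĒ(ω₁) + (1−λ)Ē(ω₂)`, by `cellEnergy_mix`, `meanEnergy_mix`,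
`cellEnergy_const`). Holds for all states. [cite: BratteliKishimotoRobinson1978, §3 (mean energy functional)] -/
theorem cellEnergy_mix_eq_meanEnergy_mix_cellAverage (Ψ : FermionInteraction d) (R : ℝ) (t : ℝ) (ht₀ : 0 ≤ t) (ht₁ : t ≤ 1)
    (ω₁ ω₂ : InfVolFermionState d) :
    (InfVolFermionState.mix t ht₀ ht₁ ω₁ ω₂).cellEnergy (fun _ : Cell q => Ψ) R =
      (InfVolFermionState.mix t ht₀ ht₁ (ω₁.cellAverage q) (ω₂.cellAverage q)).meanEnergy Ψ R := by
  rw [cellEnergy_mix, meanEnergy_mix, ω₁.cellEnergy_const, ω₂.cellEnergy_const]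

/-- The cell filling of a mixture is the convex combination of the cell fillings (restated from `cellFilling_mix` for the
`0 < λ < 1` proof terms used below). [cite: BratteliRobinsonI1987, §4.3.1] -/
theorem cellFilling_mix_of_lt {lam : ℝ} (hl0 : 0 < lam) (hl1 : lam < 1) (ω₁ ω₂ : InfVolFermionState d) :
    (InfVolFermionState.mix lam hl0.le hl1.le ω₁ ω₂).cellFilling q = lam * ω₁.cellFilling q + (1 - lam) * ω₂.cellFilling q :=
  cellFilling_mix lam hl0.le hl1.le ω₁ ω₂

/-- The cell energy of a mixture is the convex combination of the cell energies (restated from `cellEnergy_mix`, constant views).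
[cite: BratteliKishimotoRobinson1978, §3 (mean energy functional)] -/
theorem cellEnergy_mix_of_lt (Ψ : FermionInteraction d) (R : ℝ) {lam : ℝ} (hl0 : 0 < lam) (hl1 : lam < 1)
    (ω₁ ω₂ : InfVolFermionState d) :
    (InfVolFermionState.mix lam hl0.le hl1.le ω₁ ω₂).cellEnergy (fun _ : Cell q => Ψ) R =
      lam * ω₁.cellEnergy (fun _ : Cell q => Ψ) R + (1 - lam) * ω₂.cellEnergy (fun _ : Cell q => Ψ) R :=
  cellEnergy_mix (fun _ : Cell q => Ψ) R lam hl0.le hl1.le ω₁ ω₂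

/-! ### §2 GENERIC TRANSFER: a translation-invariant coexistence-exclusion sentence holds for periodic phases -/

variable {U : ℝ}

/-- **Transfer of an exclusion sentence from translation-invariant to periodic components** (`t–t'` Hubbard model of `ℤ²`,
couplings `(t, t', U)`; `P₁`, `P₂` arbitrary constraints on the two densities — thresholds, windows, …). Suppose that for ALL
translation-invariant `ω₁, ω₂` with `P₁(ρ(ω₁))`, `P₂(ρ(ω₂))` and all `0 < λ < 1` the mixture `λω₁ + (1−λ)ω₂` has mean energy
STRICTLY above `e(t,t',U,·)` at its density (the form of every `PhaseSeparationExclusion*` theorem of the programme). Then for all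
`q`-PERIODIC `ω₁, ω₂` (stripes, Néel / density-wave states, any enlarged cell) whose CELL FILLINGS satisfy `P₁(ρ̄(ω₁))`, `P₂(ρ̄(ω₂))`
and all `0 < λ < 1`, the phase-separated state `λω₁ + (1−λ)ω₂` has CELL ENERGY (energy per site) strictly above `e` at its CELL
FILLING: apply the hypothesis to the translation-invariant cell averages (`IsPeriodic.isTranslationInvariant_cellAverage`) and use §1.
[cite: Israel1979, Thm. I.2.4] [cite: BratteliRobinsonI1987, §4.3.1] -/
theorem IsPeriodic.energyDensityTT'_lt_cellEnergy_mix_of_forall_isTranslationInvariant (t t' U : ℝ) {P₁ P₂ : ℝ → Prop}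
    (hTI : ∀ ⦃ω₁ ω₂ : InfVolFermionState 2⦄, ω₁.IsTranslationInvariant → ω₂.IsTranslationInvariant →
      P₁ ω₁.density → P₂ ω₂.density → ∀ ⦃lam : ℝ⦄ (hl0 : 0 < lam) (hl1 : lam < 1),
      energyDensityTT' t t' U (InfVolFermionState.mix lam hl0.le hl1.le ω₁ ω₂).density <
        (InfVolFermionState.mix lam hl0.le hl1.le ω₁ ω₂).meanEnergy (hubbardTTPrimeFermionInteraction t t' U) 1)
    {q : Fin 2 → ℕ} {ω₁ ω₂ : InfVolFermionState 2} (h₁ : ω₁.IsPeriodic q) (h₂ : ω₂.IsPeriodic q)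
    (hP₁ : P₁ (ω₁.cellFilling q)) (hP₂ : P₂ (ω₂.cellFilling q)) {lam : ℝ} (hl0 : 0 < lam) (hl1 : lam < 1) :
    energyDensityTT' t t' U ((InfVolFermionState.mix lam hl0.le hl1.le ω₁ ω₂).cellFilling q) <
      (InfVolFermionState.mix lam hl0.le hl1.le ω₁ ω₂).cellEnergy (fun _ : Cell q => hubbardTTPrimeFermionInteraction t t' U) 1 := by
  rw [cellFilling_mix_eq_density_mix_cellAverage, cellEnergy_mix_eq_meanEnergy_mix_cellAverage]
  rw [ω₁.cellFilling_eq_density_cellAverage] at hP₁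
  rw [ω₂.cellFilling_eq_density_cellAverage] at hP₂
  exact hTI h₁.isTranslationInvariant_cellAverage h₂.isTranslationInvariant_cellAverage hP₁ hP₂ hl0 hl1

/-- **Threshold form of the transfer** (the shape of the programme's sentences: `0 < ρ(ω₁) ≤ r₁`, `r₂ ≤ ρ(ω₂) < 2`): a
translation-invariant `(ρ₁ ≤ r₁ | ρ₂ ≥ r₂)` exclusion sentence at `(t, t', U)` implies the same sentence for `q`-periodic components
with CELL FILLINGS `0 < ρ̄(ω₁) ≤ r₁`, `r₂ ≤ ρ̄(ω₂) < 2`. [cite: Israel1979, Thm. I.2.4] [cite: BratteliRobinsonI1987, §4.3.1] -/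
theorem IsPeriodic.energyDensityTT'_lt_cellEnergy_mix_of_forall_isTranslationInvariant_thresholds (t t' U : ℝ) {r₁ r₂ : ℝ}
    (hTI : ∀ ⦃ω₁ ω₂ : InfVolFermionState 2⦄, ω₁.IsTranslationInvariant → ω₂.IsTranslationInvariant →
      0 < ω₁.density → ω₁.density ≤ r₁ → r₂ ≤ ω₂.density → ω₂.density < 2 → ∀ ⦃lam : ℝ⦄ (hl0 : 0 < lam) (hl1 : lam < 1),
      energyDensityTT' t t' U (InfVolFermionState.mix lam hl0.le hl1.le ω₁ ω₂).density <
        (InfVolFermionState.mix lam hl0.le hl1.le ω₁ ω₂).meanEnergy (hubbardTTPrimeFermionInteraction t t' U) 1)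
    {q : Fin 2 → ℕ} {ω₁ ω₂ : InfVolFermionState 2} (h₁ : ω₁.IsPeriodic q) (h₂ : ω₂.IsPeriodic q)
    (hρ₁ : 0 < ω₁.cellFilling q) (hρ₁' : ω₁.cellFilling q ≤ r₁) (hρ₂ : r₂ ≤ ω₂.cellFilling q) (hρ₂' : ω₂.cellFilling q < 2)
    {lam : ℝ} (hl0 : 0 < lam) (hl1 : lam < 1) :
    energyDensityTT' t t' U ((InfVolFermionState.mix lam hl0.le hl1.le ω₁ ω₂).cellFilling q) <
      (InfVolFermionState.mix lam hl0.le hl1.le ω₁ ω₂).cellEnergy (fun _ : Cell q => hubbardTTPrimeFermionInteraction t t' U) 1 :=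
  IsPeriodic.energyDensityTT'_lt_cellEnergy_mix_of_forall_isTranslationInvariant t t' U
    (P₁ := fun ρ => 0 < ρ ∧ ρ ≤ r₁) (P₂ := fun ρ => r₂ ≤ ρ ∧ ρ < 2)
    (fun _ _ k₁ k₂ hP₁ hP₂ _ hl0 hl1 => hTI k₁ k₂ hP₁.1 hP₁.2 hP₂.1 hP₂.2 hl0 hl1)
    h₁ h₂ ⟨hρ₁, hρ₁'⟩ ⟨hρ₂, hρ₂'⟩ hl0 hl1

/-- **The cell-average reading**: under the same transfer hypothesis the CELL AVERAGE of the phase-separated state — a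
translation-invariant state with the mixture's filling and energy per site — lies strictly above the variational minimum at its
density (so some translation-invariant state of that density does strictly better: the mixture is not a ground state).
[cite: Israel1979, Thm. I.2.4] [cite: BratteliRobinsonI1987, §4.3.1] -/
theorem IsPeriodic.energyDensityTT'_lt_meanEnergy_cellAverage_mix_of_forall_isTranslationInvariant (t t' U : ℝ) {P₁ P₂ : ℝ → Prop}
    (hTI : ∀ ⦃ω₁ ω₂ : InfVolFermionState 2⦄, ω₁.IsTranslationInvariant → ω₂.IsTranslationInvariant →
      P₁ ω₁.density → P₂ ω₂.density → ∀ ⦃lam : ℝ⦄ (hl0 : 0 < lam) (hl1 : lam < 1),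
      energyDensityTT' t t' U (InfVolFermionState.mix lam hl0.le hl1.le ω₁ ω₂).density <
        (InfVolFermionState.mix lam hl0.le hl1.le ω₁ ω₂).meanEnergy (hubbardTTPrimeFermionInteraction t t' U) 1)
    {q : Fin 2 → ℕ} {ω₁ ω₂ : InfVolFermionState 2} (h₁ : ω₁.IsPeriodic q) (h₂ : ω₂.IsPeriodic q)
    (hP₁ : P₁ (ω₁.cellFilling q)) (hP₂ : P₂ (ω₂.cellFilling q)) {lam : ℝ} (hl0 : 0 < lam) (hl1 : lam < 1) :
    energyDensityTT' t t' U ((InfVolFermionState.mix lam hl0.le hl1.le ω₁ ω₂).cellAverage q).density <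
      ((InfVolFermionState.mix lam hl0.le hl1.le ω₁ ω₂).cellAverage q).meanEnergy (hubbardTTPrimeFermionInteraction t t' U) 1 := by
  rw [← InfVolFermionState.cellFilling_eq_density_cellAverage, ← InfVolFermionState.cellEnergy_const]
  exact h₁.energyDensityTT'_lt_cellEnergy_mix_of_forall_isTranslationInvariant t t' U hTI h₂ hP₁ hP₂ hl0 hl1

/-! ### §3 The certified forms for periodic phases (cap/floors super-segment, strict defect, energy gap) -/

/-- **Certified super-segment exclusion for PERIODIC phases.** `U ≥ 0`; a certified CAP `e(a n₁ + b n₂) ≤ c` and certified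
FLOORS `f₁ ≤ e(n₁)`, `f₂ ≤ e(n₂)` with positive exclusion margin `c < a f₁ + b f₂` (`a, b ≥ 0`, `a + b = 1`, `n₁ < n₂`). Then for
every pair of `q`-periodic states (stripes, Néel / density-wave states, any superlattice order with a common period lattice) with
cell fillings `0 < ρ̄(ω₁) ≤ n₁` and `n₂ ≤ ρ̄(ω₂) < 2` and every `0 < λ < 1`, the phase-separated state `λω₁ + (1−λ)ω₂` has energy per
site STRICTLY above `e` at its filling: macroscopic separation into a periodic phase of filling `≤ n₁` and one of filling `≥ n₂` is
excluded at every intermediate filling. [cite: Israel1979, Thm. I.2.4] [cite: EmeryKivelsonLin1990, pp. 475–476] -/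
theorem IsPeriodic.energyDensityTT'_lt_cellEnergy_mix_of_cap_lt_floors_of_le (t t' : ℝ) (hU : 0 ≤ U)
    {q : Fin 2 → ℕ} {ω₁ ω₂ : InfVolFermionState 2} (h₁ : ω₁.IsPeriodic q) (h₂ : ω₂.IsPeriodic q)
    (hρ₁ : 0 < ω₁.cellFilling q) (hρ₂' : ω₂.cellFilling q < 2)
    {n₁ n₂ : ℝ} (hn₁ : ω₁.cellFilling q ≤ n₁) (hn : n₁ < n₂) (hn₂ : n₂ ≤ ω₂.cellFilling q)
    {a b : ℝ} (ha : 0 ≤ a) (hb : 0 ≤ b) (hab : a + b = 1) {c f₁ f₂ : ℝ}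
    (hcap : energyDensityTT' t t' U (a * n₁ + b * n₂) ≤ c)
    (hf₁ : f₁ ≤ energyDensityTT' t t' U n₁) (hf₂ : f₂ ≤ energyDensityTT' t t' U n₂)
    (hc : c < a * f₁ + b * f₂)
    {lam : ℝ} (hl0 : 0 < lam) (hl1 : lam < 1) :
    energyDensityTT' t t' U ((InfVolFermionState.mix lam hl0.le hl1.le ω₁ ω₂).cellFilling q) <
      (InfVolFermionState.mix lam hl0.le hl1.le ω₁ ω₂).cellEnergy (fun _ : Cell q => hubbardTTPrimeFermionInteraction t t' U) 1 := by
  rw [cellFilling_mix_eq_density_mix_cellAverage, cellEnergy_mix_eq_meanEnergy_mix_cellAverage]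
  rw [ω₁.cellFilling_eq_density_cellAverage] at hρ₁ hn₁
  rw [ω₂.cellFilling_eq_density_cellAverage] at hρ₂' hn₂
  exact h₁.isTranslationInvariant_cellAverage.energyDensityTT'_lt_meanEnergy_mix_of_cap_lt_floors_of_le t t' hU
    h₂.isTranslationInvariant_cellAverage hρ₁ hρ₂' hn₁ hn hn₂ ha hb hab hcap hf₁ hf₂ hc hl0 hl1

/-- **One strict-convexity defect excludes coexistence of every pair of PERIODIC phases across it.** `U ≥ 0`;
`e(a n₁ + b n₂) < a e(n₁) + b e(n₂)` (`a, b ≥ 0`, `a + b = 1`, `n₁ < n₂`) ⇒ for `q`-periodic `ω₁, ω₂` with cell fillings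
`0 < ρ̄(ω₁) ≤ n₁`, `n₂ ≤ ρ̄(ω₂) < 2` and `0 < λ < 1`: `e(ρ̄(λω₁ + (1−λ)ω₂)) < Ē(λω₁ + (1−λ)ω₂)`.
[cite: Israel1979, Thm. I.2.4] [cite: EmeryKivelsonLin1990, pp. 475–476] -/
theorem IsPeriodic.energyDensityTT'_lt_cellEnergy_mix_of_strict_at_of_le (t t' : ℝ) (hU : 0 ≤ U)
    {q : Fin 2 → ℕ} {ω₁ ω₂ : InfVolFermionState 2} (h₁ : ω₁.IsPeriodic q) (h₂ : ω₂.IsPeriodic q)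
    (hρ₁ : 0 < ω₁.cellFilling q) (hρ₂' : ω₂.cellFilling q < 2)
    {n₁ n₂ : ℝ} (hn₁ : ω₁.cellFilling q ≤ n₁) (hn : n₁ < n₂) (hn₂ : n₂ ≤ ω₂.cellFilling q)
    {a b : ℝ} (ha : 0 ≤ a) (hb : 0 ≤ b) (hab : a + b = 1)
    (hstrict : energyDensityTT' t t' U (a * n₁ + b * n₂) <
      a * energyDensityTT' t t' U n₁ + b * energyDensityTT' t t' U n₂)
    {lam : ℝ} (hl0 : 0 < lam) (hl1 : lam < 1) :
    energyDensityTT' t t' U ((InfVolFermionState.mix lam hl0.le hl1.le ω₁ ω₂).cellFilling q) <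
      (InfVolFermionState.mix lam hl0.le hl1.le ω₁ ω₂).cellEnergy (fun _ : Cell q => hubbardTTPrimeFermionInteraction t t' U) 1 := by
  rw [cellFilling_mix_eq_density_mix_cellAverage, cellEnergy_mix_eq_meanEnergy_mix_cellAverage]
  rw [ω₁.cellFilling_eq_density_cellAverage] at hρ₁ hn₁
  rw [ω₂.cellFilling_eq_density_cellAverage] at hρ₂' hn₂
  exact h₁.isTranslationInvariant_cellAverage.energyDensityTT'_lt_meanEnergy_mix_of_strict_at_of_le t t' hU
    h₂.isTranslationInvariant_cellAverage hρ₁ hρ₂' hn₁ hn hn₂ ha hb hab hstrict hl0 hl1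

/-- **Energy per site of a phase-separated state of two PERIODIC phases from certified floors**: `f_i ≤ e(ρ̄(ω_i))`
(`0 < ρ̄ < 2`) ⇒ `λf₁ + (1−λ)f₂ ≤ Ē(λω₁ + (1−λ)ω₂)` (each periodic component obeys the variational principle through its cell
average, `IsPeriodic.energyDensityTT'_le_cellAvg`; the cell energy is affine). [cite: Israel1979, Thm. I.2.4] -/
theorem IsPeriodic.convexComb_floors_le_cellEnergy_mix (t t' : ℝ) (hU : 0 ≤ U)
    {q : Fin 2 → ℕ} {ω₁ ω₂ : InfVolFermionState 2} (h₁ : ω₁.IsPeriodic q) (h₂ : ω₂.IsPeriodic q)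
    (hρ₁ : 0 < ω₁.cellFilling q) (hρ₁' : ω₁.cellFilling q < 2) (hρ₂ : 0 < ω₂.cellFilling q) (hρ₂' : ω₂.cellFilling q < 2)
    {f₁ f₂ : ℝ} (hf₁ : f₁ ≤ energyDensityTT' t t' U (ω₁.cellFilling q)) (hf₂ : f₂ ≤ energyDensityTT' t t' U (ω₂.cellFilling q))
    {lam : ℝ} (hl0 : 0 ≤ lam) (hl1 : lam ≤ 1) :
    lam * f₁ + (1 - lam) * f₂ ≤
      (InfVolFermionState.mix lam hl0 hl1 ω₁ ω₂).cellEnergy (fun _ : Cell q => hubbardTTPrimeFermionInteraction t t' U) 1 := by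
  rw [cellEnergy_mix_eq_meanEnergy_mix_cellAverage]
  rw [ω₁.cellFilling_eq_density_cellAverage] at hρ₁ hρ₁' hf₁
  rw [ω₂.cellFilling_eq_density_cellAverage] at hρ₂ hρ₂' hf₂
  exact h₁.isTranslationInvariant_cellAverage.convexComb_floors_le_meanEnergy_mix t t' hU
    h₂.isTranslationInvariant_cellAverage hρ₁ hρ₁' hρ₂ hρ₂' hf₁ hf₂ hl0 hl1

/-- **Energy gap of the phase-separated state of two PERIODIC phases**: with certified floors `f_i ≤ e(ρ̄(ω_i))` and a certified cap
`e(λρ̄(ω₁) + (1−λ)ρ̄(ω₂)) ≤ c`: `e(ρ̄(mixture)) + (λf₁ + (1−λ)f₂ − c) ≤ Ē(mixture)` — the striped / ordered phase mixture lies at least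
the EXCLUSION MARGIN per site above the ground-state energy density at its own filling. [cite: EmeryKivelsonLin1990, pp. 475–476] -/
theorem IsPeriodic.energyDensityTT'_add_margin_le_cellEnergy_mix (t t' : ℝ) (hU : 0 ≤ U)
    {q : Fin 2 → ℕ} {ω₁ ω₂ : InfVolFermionState 2} (h₁ : ω₁.IsPeriodic q) (h₂ : ω₂.IsPeriodic q)
    (hρ₁ : 0 < ω₁.cellFilling q) (hρ₁' : ω₁.cellFilling q < 2) (hρ₂ : 0 < ω₂.cellFilling q) (hρ₂' : ω₂.cellFilling q < 2)
    {c f₁ f₂ : ℝ} (hf₁ : f₁ ≤ energyDensityTT' t t' U (ω₁.cellFilling q)) (hf₂ : f₂ ≤ energyDensityTT' t t' U (ω₂.cellFilling q))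
    {lam : ℝ} (hl0 : 0 ≤ lam) (hl1 : lam ≤ 1)
    (hcap : energyDensityTT' t t' U (lam * ω₁.cellFilling q + (1 - lam) * ω₂.cellFilling q) ≤ c) :
    energyDensityTT' t t' U ((InfVolFermionState.mix lam hl0 hl1 ω₁ ω₂).cellFilling q) + (lam * f₁ + (1 - lam) * f₂ - c) ≤
      (InfVolFermionState.mix lam hl0 hl1 ω₁ ω₂).cellEnergy (fun _ : Cell q => hubbardTTPrimeFermionInteraction t t' U) 1 := by
  have h := h₁.convexComb_floors_le_cellEnergy_mix t t' hU h₂ hρ₁ hρ₁' hρ₂ hρ₂' hf₁ hf₂ hl0 hl1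
  rw [cellFilling_mix]
  linarith

/-! ### §4 Two phases with DIFFERENT period lattices: pass to a common coarsening -/

/-- The product cell is a common coarsening: `q₁_i + 1 ∣ ((q₁_i + 1)(q₂_i + 1) − 1) + 1`. [cite: ArakiMoriya2003, §4.1 Def. 4.5] -/
theorem succ_dvd_prodPeriod_left (q₁ q₂ : Fin d → ℕ) (i : Fin d) :
    (q₁ i + 1) ∣ ((fun j => (q₁ j + 1) * (q₂ j + 1) - 1) i + 1) := by
  have h : (q₁ i + 1) * (q₂ i + 1) - 1 + 1 = (q₁ i + 1) * (q₂ i + 1) :=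
    Nat.sub_add_cancel (Nat.one_le_iff_ne_zero.2 (Nat.mul_ne_zero (Nat.succ_ne_zero _) (Nat.succ_ne_zero _)))
  simp only [h]
  exact Dvd.intro _ rfl

/-- The product cell is a common coarsening: `q₂_i + 1 ∣ ((q₁_i + 1)(q₂_i + 1) − 1) + 1`. [cite: ArakiMoriya2003, §4.1 Def. 4.5] -/
theorem succ_dvd_prodPeriod_right (q₁ q₂ : Fin d → ℕ) (i : Fin d) :
    (q₂ i + 1) ∣ ((fun j => (q₁ j + 1) * (q₂ j + 1) - 1) i + 1) := by
  have h : (q₁ i + 1) * (q₂ i + 1) - 1 + 1 = (q₁ i + 1) * (q₂ i + 1) :=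
    Nat.sub_add_cancel (Nat.one_le_iff_ne_zero.2 (Nat.mul_ne_zero (Nat.succ_ne_zero _) (Nat.succ_ne_zero _)))
  simp only [h]
  exact Dvd.intro_left _ rfl

/-- **Two periodic phases are periodic under a common lattice**: a `q₁`-periodic and a `q₂`-periodic state are both `Q`-periodic for
`Q_i + 1 = (q₁_i + 1)(q₂_i + 1)` (`IsPeriodic.of_dvd`), so §2–§3 apply to ANY two superlattice-ordered phases with the cell numbers
read over the product cell. [cite: ArakiMoriya2003, §4.1 Def. 4.5] -/
theorem IsPeriodic.isPeriodic_prodPeriod_left {q₁ q₂ : Fin d → ℕ} {ω : InfVolFermionState d} (h : ω.IsPeriodic q₁) :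
    ω.IsPeriodic (fun j => (q₁ j + 1) * (q₂ j + 1) - 1) :=
  h.of_dvd (succ_dvd_prodPeriod_left q₁ q₂)

/-- The `q₂`-periodic partner is periodic under the same product lattice. [cite: ArakiMoriya2003, §4.1 Def. 4.5] -/
theorem IsPeriodic.isPeriodic_prodPeriod_right {q₁ q₂ : Fin d → ℕ} {ω : InfVolFermionState d} (h : ω.IsPeriodic q₂) :
    ω.IsPeriodic (fun j => (q₁ j + 1) * (q₂ j + 1) - 1) :=
  h.of_dvd (succ_dvd_prodPeriod_right q₁ q₂)

/-- **Transfer to two phases with different period lattices** (threshold form): a translation-invariant `(ρ₁ ≤ r₁ | ρ₂ ≥ r₂)`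
exclusion sentence at `(t, t', U)` implies, for a `q₁`-periodic `ω₁` and a `q₂`-periodic `ω₂` whose cell fillings over the product
cell `Q` (`Q_i + 1 = (q₁_i+1)(q₂_i+1)`) satisfy `0 < ρ̄(ω₁) ≤ r₁`, `r₂ ≤ ρ̄(ω₂) < 2`, that every phase-separated state `λω₁ + (1−λ)ω₂`
(`0 < λ < 1`) has energy per site strictly above `e` at its filling. [cite: Israel1979, Thm. I.2.4] [cite: BratteliRobinsonI1987, §4.3.1] -/
theorem IsPeriodic.energyDensityTT'_lt_cellEnergy_mix_of_forall_isTranslationInvariant_thresholds₂ (t t' U : ℝ) {r₁ r₂ : ℝ}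
    (hTI : ∀ ⦃ω₁ ω₂ : InfVolFermionState 2⦄, ω₁.IsTranslationInvariant → ω₂.IsTranslationInvariant →
      0 < ω₁.density → ω₁.density ≤ r₁ → r₂ ≤ ω₂.density → ω₂.density < 2 → ∀ ⦃lam : ℝ⦄ (hl0 : 0 < lam) (hl1 : lam < 1),
      energyDensityTT' t t' U (InfVolFermionState.mix lam hl0.le hl1.le ω₁ ω₂).density <
        (InfVolFermionState.mix lam hl0.le hl1.le ω₁ ω₂).meanEnergy (hubbardTTPrimeFermionInteraction t t' U) 1)
    {q₁ q₂ : Fin 2 → ℕ} {ω₁ ω₂ : InfVolFermionState 2} (h₁ : ω₁.IsPeriodic q₁) (h₂ : ω₂.IsPeriodic q₂)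
    (hρ₁ : 0 < ω₁.cellFilling (fun j => (q₁ j + 1) * (q₂ j + 1) - 1))
    (hρ₁' : ω₁.cellFilling (fun j => (q₁ j + 1) * (q₂ j + 1) - 1) ≤ r₁)
    (hρ₂ : r₂ ≤ ω₂.cellFilling (fun j => (q₁ j + 1) * (q₂ j + 1) - 1))
    (hρ₂' : ω₂.cellFilling (fun j => (q₁ j + 1) * (q₂ j + 1) - 1) < 2)
    {lam : ℝ} (hl0 : 0 < lam) (hl1 : lam < 1) :
    energyDensityTT' t t' U ((InfVolFermionState.mix lam hl0.le hl1.le ω₁ ω₂).cellFilling (fun j => (q₁ j + 1) * (q₂ j + 1) - 1)) <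
      (InfVolFermionState.mix lam hl0.le hl1.le ω₁ ω₂).cellEnergy
        (fun _ : Cell (fun j => (q₁ j + 1) * (q₂ j + 1) - 1) => hubbardTTPrimeFermionInteraction t t' U) 1 :=
  IsPeriodic.energyDensityTT'_lt_cellEnergy_mix_of_forall_isTranslationInvariant_thresholds t t' U hTI
    h₁.isPeriodic_prodPeriod_left h₂.isPeriodic_prodPeriod_right hρ₁ hρ₁' hρ₂ hρ₂' hl0 hl1

end InfVolFermionState

end Literature.MathematicalPhysics.QuantumLattice

end
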